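import Mathlib
import Summits.Ventures.HodgeRepro2.NonVanishingHodgePeriod
import Summits.Ventures.HodgeRepro2.MultiplicityOnePeriod
import Summits.Ventures.HodgeRepro2.HeckeFiniteIndex

/-!
# NonVanishingHeckeEigenform — from the Tier-3 input to a simultaneous Hecke eigenform

Blind cell `pub-hodge-repro2`, seat p2 (Tier 3 → Tier 5 kernel chain).

The Tier-3 hypothesis shape `NonVanishingInput` (`Hypothesis.lean`, row 1) yields, on a
torsion-free subgroup `S' ⊆ Γ_N` of finite index in `Γ_1` with `S'\𝔹²` compact, a holomorphic
weight-3 form `f ≢ 0` (`NonVanishingPeterssonCompact.lean`, row 111, and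
`NonVanishingHodgePeriod.lean`, row 119). Its class in the Petersson space of `S'` is a non-zero
element of the holomorphic part (`PeterssonSpace.lean`, `HolomorphicPeterssonSpace.lean`), the
Hecke operators of `S'` are defined and adjoint in pairs because `S'` has finite index in `Γ_1`
(`HeckeFiniteIndex.lean`), and — once the holomorphic part is finite-dimensional and the Hecke
operators of an inversion-closed family commute (prose, carried as hypotheses) — Parseval on the
joint Hecke eigenbasis (`MultiplicityOnePeriod.lean`) exhibits a unit simultaneous Hecke eigenform
`v` with `⟪v, f⟫ ≠ 0`.

This file states that composition as one theorem: **the Tier-3 input produces a simultaneous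
Hecke eigenform of weight 3 with a non-zero Petersson projection of the vertex wedge form**.
-/

namespace Summit.Ventures.HodgeRepro2.ShimuraData

open MeasureTheory JointEigenbasis

variable {K : Type*} [Field K] [NumberField K] [NumberField.IsCMField K] {τ₁ : K →+* ℂ}
  {H : Matrix (Fin 3) (Fin 3) K} {Q : Matrix (Fin 3) (Fin 3) ℂ} {𝔪 : Submodule ℤ (Fin 3 → K)}

/-- **The Tier-3 input produces a simultaneous Hecke eigenform.** Under `NonVanishingInput`,
`N > 2` and the compactness of `Γ_1\𝔹²`: there are a torsion-free `S' ⊆ Γ_N` of finite index in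
`Γ_1` with `S'\𝔹²` compact, a measurable fundamental domain `D` of `S'`, and a holomorphic
weight-3 form `f` for `S'` whose class `mk f` in the Petersson space of `S'` is a NON-ZERO element
of the holomorphic part, such that for every inversion-closed family of rational unitary matrices
whose Hecke operators (finite-index instances) commute pairwise and for which the holomorphic part
is finite-dimensional, there is a unit simultaneous Hecke eigenform `v` in the holomorphic part
with `⟪v, mk f⟫ ≠ 0`. -/
theorem NonVanishingInput.exists_hecke_eigenform (hH : IsHermitianForm K H)
    (hdef : ∀ τ : K →+* ℂ, NumberField.InfinitePlace.mk τ ≠ NumberField.InfinitePlace.mk τ₁ →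
      IsDefiniteAt K τ H)
    (hQ : IsFrame K τ₁ H Q) (h𝔪 : IsLattice K 𝔪) (hnv : NonVanishingInput K τ₁ H 𝔪 Q) {N : ℕ}
    (hN : 2 < N)
    [CompactSpace (ballQuotient hQ (shimuraLevelSubgroup K H 𝔪 1)
      (shimuraLevelSubgroup_one_subset_unitaryGroup H 𝔪))] :
    ∃ S' : Subgroup (GL (Fin 3) K), ∃ hS' : (S' : Set (GL (Fin 3) K)) ⊆ shimuraLevel K H 𝔪 N,
      IsTorsionFreeSet K (S' : Set (GL (Fin 3) K)) ∧
      ∃ hS₁ : S' ≤ shimuraLevelSubgroup K H 𝔪 1,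
      ∃ hfin : (S'.subgroupOf (shimuraLevelSubgroup K H 𝔪 1)).FiniteIndex,
      ∃ _hc : CompactSpace (ballQuotient hQ S' (subset_unitaryGroup_of_subset_shimuraLevel hS')),
      ∃ D : Set ball₂, ∃ hDm : MeasurableSet D,
      ∃ hD : IsBallFundamentalDomain hQ S' (subset_unitaryGroup_of_subset_shimuraLevel hS') D,
      ∃ f : PeterssonForms hQ S' (subset_unitaryGroup_of_subset_shimuraLevel hS') 3 hD,
        f ∈ holomorphicForms hQ S' _ 3 hD ∧
        (SeparationQuotient.mk f : PeterssonSpace hQ S' _ 3 hD) ≠ 0 ∧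
        ∀ (ι : Type) (δ : ι → unitaryGroup K H) (σ : ι → ι), (∀ i, δ (σ i) = (δ i)⁻¹) →
          (∀ i j, Commute
            (heckeFamilyOf hQ S' _ 3 hD hDm
              (fun δ => fintypeHeckeQuotientOfFiniteIndex h𝔪 hS₁ hfin δ.2) (δ i))
            (heckeFamilyOf hQ S' _ 3 hD hDm
              (fun δ => fintypeHeckeQuotientOfFiniteIndex h𝔪 hS₁ hfin δ.2) (δ j))) →
          FiniteDimensional ℂ (holomorphicSpace hQ S' _ 3 hD) →
          ∃ v : PeterssonSpace hQ S' _ 3 hD, v ∈ holomorphicSpace hQ S' _ 3 hD ∧ ‖v‖ = 1 ∧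
            (∀ i, ∃ μ : ℂ, heckeFamilyOf hQ S' _ 3 hD hDm
              (fun δ => fintypeHeckeQuotientOfFiniteIndex h𝔪 hS₁ hfin δ.2) (δ i) v = μ • v) ∧
            inner ℂ v (SeparationQuotient.mk f : PeterssonSpace hQ S' _ 3 hD) ≠ 0 := by
  obtain ⟨S', hS', htf, hfi, f₀, hf₀, hdiff, ⟨z₀, hz₀, h0⟩, -, -, -⟩ :=
    hnv.exists_setIntegral_petersson_pos_of_compactSpace hH hdef hQ h𝔪 hN
  have hle : S' ≤ shimuraLevelSubgroup K H 𝔪 1 := by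
    intro γ hγ
    have h1 : (S' : Set (GL (Fin 3) K)) ⊆ shimuraLevelSubgroup K H 𝔪 1 := by
      rw [coe_shimuraLevelSubgroup]
      exact hS'.trans (shimuraLevel_subset_of_dvd H 𝔪 (Nat.one_dvd N))
    exact h1 hγ
  haveI := hfi
  haveI hc : CompactSpace (ballQuotient hQ S' (subset_unitaryGroup_of_subset_shimuraLevel hS')) :=
    compactSpace_ballQuotient_of_le hQ hle (shimuraLevelSubgroup_one_subset_unitaryGroup H 𝔪)
  obtain ⟨D, hDm, hD⟩ := exists_isBallFundamentalDomain hH hdef hQ h𝔪 hS' htf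
  have hfc : ContinuousOn f₀ ball₂ := hdiff.continuousOn
  let f : PeterssonForms hQ S' (subset_unitaryGroup_of_subset_shimuraLevel hS') 3 hD :=
    PeterssonForms.ofForm hQ S' _ 3 hD ⟨f₀, (mem_weightForms τ₁ Q S' 3).mpr ⟨hf₀, hfc⟩⟩
  have hfhol : f ∈ holomorphicForms hQ S' _ 3 hD := hdiff
  have hfne : (SeparationQuotient.mk f : PeterssonSpace hQ S' _ 3 hD) ≠ 0 :=
    (PeterssonSpace.mk_ne_zero_iff hQ S' _ 3 hD f).mpr ⟨z₀, hz₀, h0⟩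
  refine ⟨S', hS', htf, hle, hfi, hc, D, hDm, hD, f, hfhol, hfne, ?_⟩
  intro ι δ σ hσ hcomm hfd
  -- the period of `f` against itself is non-zero
  have hper : ∫ x in Subtype.val '' D, hodgeWedge f₀ f₀ x ≠ 0 := by
    intro h
    have := setIntegral_hodgeWedge_self_re_pos hQ S' _ hD hDm hf₀ hfc hz₀ h0
    rw [h, Complex.zero_re] at this
    exact lt_irrefl _ this
  obtain ⟨b, hb⟩ := exists_orthonormalBasis_heckeSpace_holomorphic_of_finiteIndex hQ S' _ 3 hD hDm
    h𝔪 hle hfi δ σ hσ hcomm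
  obtain ⟨a, -, haf⟩ := exists_inner_ne_zero_of_setIntegral_hodgeWedge_ne_zero hQ S' _ hD hDm
    (holomorphicSpace hQ S' _ 3 hD) b f f (mk_mem_holomorphicSpace hQ S' _ 3 hD hfhol)
    (mk_mem_holomorphicSpace hQ S' _ 3 hD hfhol) hper
  refine ⟨b a, (b a).2, (Submodule.norm_coe (b a)).trans (b.orthonormal.1 a), hb a, haf⟩

end Summit.Ventures.HodgeRepro2.ShimuraData
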